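import Summits.BirchSwinnertonDyer.BirchSwinnertonDyer.Theorems.EisensteinPrimesIndexInputsShell
import Summits.BirchSwinnertonDyer.BirchSwinnertonDyer.Theorems.EisensteinPrimesIndexInputsH2
import Literature.NumberTheory.GaloisCohomology.PoitouTateRestrictedRamification
import HarnessLib

/-!
# Crux `GoodLatticeBDPValue` (stmt-BirchSwinnertonDyer-19032), line `halves` v20.2: the registered KERNEL stub
# `stub_indexInputs` CLOSED — the inputs of the V21 index road, assembled from the width seats' files

Cell `bsd-eis` (run/shared/lean/pub/bsd-eis/), seat `bsd-line-x1-p1` LEAD g4. The statement is the registered one VERBATIM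
(`Cruxes/GoodLatticeBDPValue/Lines/halves.lean` v20.2, sha256 2026857c759a9505…): kernel modulo its ten PUBLISHED antecedents
(Greenberg 2016 Props. 4.1.1/4.2.2, Greenberg 2006 §5 A / Props. 4.1, 4.2, 3.2, BCGKPST 2020 §3.3, weak Leopoldt above the
cyclotomic line, Greenberg 2016 Prop. 2.6.3, NSW (8.3.18)). The proof is two lines: width seat w7's SHELL
`IndexInputsShell.indexInputs_of_H2` (everything but the `H²` conjunct: (R) w5 `IndexInputsReps`, Kummer/LEAD g3
`ResidualPairStableLine`, (U) `IndexInputsUnramified`, SUR ×3 w3 `AcTwistDeformationSurAtVbarFin/…OfForallDatum`, COT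
`IndexInputsCot`, `H⁰` w7 `ResidualIndexHZero`) fed with width seat w4 gen 5's `IndexInputsH2.natCard_H2_conjunct` (the `H²`
bookkeeping from `cd_p(G_{K,Σ}) ≤ 2` + weak Leopoldt for the three modules, w2 gen 4). HONEST FRAMING: closes ONE registered stub
of the line (`--supports stmt-BirchSwinnertonDyer-19032`); the crux / KY Thm. 1.4.1 (iii) / IMC2 / BSD are NOT proved here
(`stub_indexPlumbing`, `stub_anThreeTrivial` and the PUB stubs remain). References: [KellerYin2024] §1.3–1.4 (arXiv:2402.12781v2);
[PollackWeston2011] Prop. A.2; [Greenberg2016Selmer] Prop. 2.6.3; [NeukirchSchmidtWingberg2008] (8.3.18).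
-/

-- D-0017: single-problem summit, the namespace repeats the problem name by design.
set_option linter.dupNamespace false
set_option autoImplicit false

noncomputable section

open scoped Classical

open PowerSeries WeierstrassCurve NumberField IsDedekindDomain Field
  Literature.NumberTheory.GaloisRepresentations Literature.NumberTheory.EllipticCurves.GreenbergVatsal2000
  Literature.NumberTheory.EllipticCurves Literature.NumberTheory.EllipticCurves.ModularForms
  Literature.NumberTheory.EllipticCurves.Rank1Residual Literature.NumberTheory.EllipticCurves.Castella2018
  Literature.NumberTheory.EllipticCurves.GreenbergSelmer Literature.NumberTheory.QuadraticFields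
  Literature.NumberTheory.EllipticCurves.CastellaGrossiLeeSkinner2022
  Literature.NumberTheory.EllipticCurves.KellerYin2024 Literature.NumberTheory.EllipticCurves.IwasawaAlgebra
  Literature.NumberTheory.EllipticCurves.BCGKPST2020
open Literature.NumberTheory.IwasawaTheory Literature.NumberTheory.IwasawaTheory.Greenberg2016
  Literature.NumberTheory.IwasawaTheory.Greenberg2006
open Summit.BirchSwinnertonDyer.Rank1Residual.X2.ResidualDevissageModules
  Summit.BirchSwinnertonDyer.BirchSwinnertonDyer.Theorems

namespace Summit.BirchSwinnertonDyer.BirchSwinnertonDyer.Theorems.GoodLatticeBDPValueIndexStubs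

/-- **Stub 2a-I of halves v20.2 — `stub_indexInputs` — PROVED (kernel modulo its PUB antecedents)**, under the name
`indexInputs` (the registry stores stub signatures truncated at 3 900 characters, so this 10 400-character statement cannot be
credited by the verbatim matcher; the skeleton v20.3 calls this theorem instead of the stub). The registered statement verbatim; proof = w7's `IndexInputsShell.indexInputs_of_H2` + w4 gen 5's `IndexInputsH2.natCard_H2_conjunct`.
[cite: KellerYin2024, Prop. 1.3.2 and §1.4 (arXiv:2402.12781v2 TeX L700–760, L1178–1330)] [cite: PollackWeston2011, Prop. A.2]
[cite: NeukirchSchmidtWingberg2008, (8.3.18), (7.1.8)(i)] [cite: Greenberg2016Selmer, Prop. 2.6.3] -/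
theorem indexInputs :
    prop411_selmer_isAlmostDivisible → prop422_localCohomology_isAlmostDivisible →
    sec5A_localH2_subsingleton_of_LOC1 → prop41_globalEulerPoincareCorank → prop42_localEulerPoincareCorank →
    prop32_cohomology_isCofinitelyGenerated → BCGKPST2020.sec33_rubin_unrSelmer₂_finite_torsion →
    weakLeopoldt_H2_subsingleton_above_cyclotomic_of_isOpen → prop263_sur_of_crk →
    (∀ (L : Type) [Field L] [NumberField L], Literature.NumberTheory.GaloisCohomology.groupCdLE_two_galoisGroupUnramifiedOutside L) →
    ∀ (W : WeierstrassCurve ℚ) [W.IsElliptic] [W.IsGloballyMinimal] (p : ℕ) [Fact p.Prime],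
      2 < p → Good W p → Red W p → Anom W p →
      (∀ Φ : AddSubgroup (geomTorsion W (p : ℤ)), IsRationalLine W p Φ → ¬ LineUnramifiedAt W p Φ) →
      ∀ (K : Type) [Field K] [NumberField K], IsImaginaryQuadratic K →
        SatisfiesHeegnerHypothesis (W.conductorNorm ℤ) K → SatisfiesHeegnerHypothesis p K →
        (∀ Q : (W.baseChange K).toAffine.Point, p • Q = 0 → Q = 0) →
      ∀ (ι : K →+* ℚ_[p]) (v vbar : HeightOneSpectrum (𝓞 K)),
        (∀ x : 𝓞 K, x ∈ v.asIdeal ↔ ‖ι (x : K)‖ < 1) →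
        ((p : ℕ) : 𝓞 K) ∈ vbar.asIdeal → vbar ≠ v →
      ∀ (κ : ZpExtension K p), κ.IsAnticyclotomic →
      ∀ (γ : absoluteGaloisGroup K) [Fact (κ.IsTopGenerator γ)],
      ∀ (θsub θquot : FramedGaloisRep K (padicCoeffIntegers (∅ : Set (PadicAlgCl p))) 1),
        IsResidualPairOver (W.baseChange K) p θsub θquot →
      ∀ (Sf : Finset (HeightOneSpectrum (𝓞 K))),
        (∀ w : HeightOneSpectrum (𝓞 K), w ∈ Sf ↔ ((W.conductorNorm ℤ : ℤ) : 𝓞 K) ∈ w.asIdeal) →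
      Module.Finite (IwasawaAlgebra p) (AcSelmer.XAc (W.baseChange K) p κ vbar (↑Sf : Set (HeightOneSpectrum (𝓞 K))) γ) →
      Module.IsTorsion (IwasawaAlgebra p) (AcSelmer.XAc (W.baseChange K) p κ vbar (↑Sf : Set (HeightOneSpectrum (𝓞 K))) γ) →
      muInvariant p (AcSelmer.XAc (W.baseChange K) p κ vbar (↑Sf : Set (HeightOneSpectrum (𝓞 K))) γ) = 0 →
      (∀ D : DatumDualData κ γ (charModule ∅ θsub)
          (AcSelmer.bdpData (charModule ∅ θsub) p vbar) (↑Sf : Set (HeightOneSpectrum (𝓞 K))),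
        Module.Finite (IwasawaAlgebra p) D.X ∧ Module.IsTorsion (IwasawaAlgebra p) D.X ∧ muInvariant p D.X = 0) →
      (∀ D : DatumDualData κ γ (charModule ∅ θquot)
          (AcSelmer.bdpData (charModule ∅ θquot) p vbar) (↑Sf : Set (HeightOneSpectrum (𝓞 K))),
        Module.Finite (IwasawaAlgebra p) D.X ∧ Module.IsTorsion (IwasawaAlgebra p) D.X ∧ muInvariant p D.X = 0) →
      ∃ (c : ℕ) (τ : ℕ → absoluteGaloisGroup K)
        (Φ : StableSubgroup (absoluteGaloisGroup K) ↥((W.baseChange K).geomTorsion (p : ℤ)))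
        (j₁ : Φ.Sub →+ charModule ∅ θsub) (j₃ : Φ.Quot →+ charModule ∅ θquot)
        (hj₁ : ∀ (g : absoluteGaloisGroup K) (a : Φ.Sub), j₁ (g • a) = g • j₁ a)
        (hj₃ : ∀ (g : absoluteGaloisGroup K) (a : Φ.Quot), j₃ (g • a) = g • j₃ a),
        -- (R) representatives
        (∀ i : ℕ, κ (τ i) = Multiplicative.ofAdd ((i : ℕ) : ℤ_[p])) ∧
        (∀ i j : ℕ, i < p ^ c → j < p ^ c → i ≠ j → ∀ δ ∈ decomp vbar,
          Multiplicative.ofAdd ((j : ℕ) : ℤ_[p]) ≠ Multiplicative.ofAdd ((i : ℕ) : ℤ_[p]) * κ δ) ∧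
        (∀ x : subgroupH1 κ.kerSubgroup (charModule ∅ θsub),
          (∀ i, i < p ^ c → resOfLe (charModule ∅ θsub) (inf_le_left : κ.kerSubgroup ⊓ decomp vbar ≤ κ.kerSubgroup) (conjH1 κ.kerSubgroup (charModule ∅ θsub) (τ i) x) = 0) →
            ∀ σ : absoluteGaloisGroup K, resOfLe (charModule ∅ θsub) (inf_le_left : κ.kerSubgroup ⊓ decomp vbar ≤ κ.kerSubgroup) (conjH1 κ.kerSubgroup (charModule ∅ θsub) σ x) = 0) ∧
        (∀ x : subgroupH1 κ.kerSubgroup ↥((W.baseChange K).geomPrimaryTorsion p),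
          (∀ i, i < p ^ c → resOfLe ↥((W.baseChange K).geomPrimaryTorsion p) (inf_le_left : κ.kerSubgroup ⊓ decomp vbar ≤ κ.kerSubgroup) (conjH1 κ.kerSubgroup ↥((W.baseChange K).geomPrimaryTorsion p) (τ i) x) = 0) →
            ∀ σ : absoluteGaloisGroup K, resOfLe ↥((W.baseChange K).geomPrimaryTorsion p) (inf_le_left : κ.kerSubgroup ⊓ decomp vbar ≤ κ.kerSubgroup) (conjH1 κ.kerSubgroup ↥((W.baseChange K).geomPrimaryTorsion p) σ x) = 0) ∧
        (∀ x : subgroupH1 κ.kerSubgroup (charModule ∅ θquot),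
          (∀ i, i < p ^ c → resOfLe (charModule ∅ θquot) (inf_le_left : κ.kerSubgroup ⊓ decomp vbar ≤ κ.kerSubgroup) (conjH1 κ.kerSubgroup (charModule ∅ θquot) (τ i) x) = 0) →
            ∀ σ : absoluteGaloisGroup K, resOfLe (charModule ∅ θquot) (inf_le_left : κ.kerSubgroup ⊓ decomp vbar ≤ κ.kerSubgroup) (conjH1 κ.kerSubgroup (charModule ∅ θquot) σ x) = 0) ∧
        -- the Kummer embeddings
        Function.Injective j₁ ∧ Function.Injective j₃ ∧
        (∀ x : charModule ∅ θsub, x ∈ j₁.range ↔ p • x = 0) ∧ (∀ x : charModule ∅ θquot, x ∈ j₃.range ↔ p • x = 0) ∧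
        (∀ x : ↥((W.baseChange K).geomPrimaryTorsion p), x ∈ (AddSubgroup.inclusion (geomTorsion_le_geomPrimaryTorsion (W.baseChange K) p)).range ↔ p • x = 0) ∧
        (∀ x : ↥((W.baseChange K).geomPrimaryTorsion p), ∃ x' : ↥((W.baseChange K).geomPrimaryTorsion p), p • x' = x) ∧
        -- (U)
        (∀ w : HeightOneSpectrum (𝓞 K), w ∉ (↑Sf : Set (HeightOneSpectrum (𝓞 K))) → ((p : ℕ) : 𝓞 K) ∉ w.asIdeal →
          Function.Injective (resH1Hom (ContinuousMonoidHom.id (inertiaIn κ.kerSubgroup w)) Φ.incl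
            (fun g m ↦ Φ.incl_smul ((g : decomp (K := K) w) : absoluteGaloisGroup K) m))) ∧
        (∀ w : HeightOneSpectrum (𝓞 K), w ∉ (↑Sf : Set (HeightOneSpectrum (𝓞 K))) → ((p : ℕ) : 𝓞 K) ∉ w.asIdeal →
          Function.Injective (resH1Hom (ContinuousMonoidHom.id (inertiaIn κ.kerSubgroup w)) j₁
            (fun g m ↦ hj₁ ((g : decomp (K := K) w) : absoluteGaloisGroup K) m))) ∧
        (∀ w : HeightOneSpectrum (𝓞 K), w ∉ (↑Sf : Set (HeightOneSpectrum (𝓞 K))) → ((p : ℕ) : 𝓞 K) ∉ w.asIdeal →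
          Function.Injective (resH1Hom (ContinuousMonoidHom.id (inertiaIn κ.kerSubgroup w)) (AddSubgroup.inclusion (geomTorsion_le_geomPrimaryTorsion (W.baseChange K) p))
            (fun (g : inertiaIn κ.kerSubgroup w) (m : ↥((W.baseChange K).geomTorsion (p : ℤ))) ↦
              (rfl : (AddSubgroup.inclusion (geomTorsion_le_geomPrimaryTorsion (W.baseChange K) p)) (((g : decomp (K := K) w) : absoluteGaloisGroup K) • m) =
                ((g : decomp (K := K) w) : absoluteGaloisGroup K) • (AddSubgroup.inclusion (geomTorsion_le_geomPrimaryTorsion (W.baseChange K) p)) m)))) ∧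
        (∀ w : HeightOneSpectrum (𝓞 K), w ∉ (↑Sf : Set (HeightOneSpectrum (𝓞 K))) → ((p : ℕ) : 𝓞 K) ∉ w.asIdeal →
          Function.Injective (resH1Hom (ContinuousMonoidHom.id (inertiaIn κ.kerSubgroup w)) j₃
            (fun g m ↦ hj₃ ((g : decomp (K := K) w) : absoluteGaloisGroup K) m))) ∧
        -- SUR
        (∀ y : Fin (p ^ c) → subgroupH1 (κ.kerSubgroup ⊓ decomp vbar) (charModule ∅ θsub), ∃ u ∈ unramifiedOutside κ.kerSubgroup (charModule ∅ θsub) p (↑Sf : Set (HeightOneSpectrum (𝓞 K))),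
          ∀ i : Fin (p ^ c), resOfLe (charModule ∅ θsub) (inf_le_left : κ.kerSubgroup ⊓ decomp vbar ≤ κ.kerSubgroup) (conjH1 κ.kerSubgroup (charModule ∅ θsub) (τ i) u) = y i) ∧
        (∀ y : Fin (p ^ c) → subgroupH1 (κ.kerSubgroup ⊓ decomp vbar) ↥((W.baseChange K).geomPrimaryTorsion p), ∃ u ∈ unramifiedOutside κ.kerSubgroup ↥((W.baseChange K).geomPrimaryTorsion p) p (↑Sf : Set (HeightOneSpectrum (𝓞 K))),
          ∀ i : Fin (p ^ c), resOfLe ↥((W.baseChange K).geomPrimaryTorsion p) (inf_le_left : κ.kerSubgroup ⊓ decomp vbar ≤ κ.kerSubgroup) (conjH1 κ.kerSubgroup ↥((W.baseChange K).geomPrimaryTorsion p) (τ i) u) = y i) ∧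
        (∀ y : Fin (p ^ c) → subgroupH1 (κ.kerSubgroup ⊓ decomp vbar) (charModule ∅ θquot), ∃ u ∈ unramifiedOutside κ.kerSubgroup (charModule ∅ θquot) p (↑Sf : Set (HeightOneSpectrum (𝓞 K))),
          ∀ i : Fin (p ^ c), resOfLe (charModule ∅ θquot) (inf_le_left : κ.kerSubgroup ⊓ decomp vbar ≤ κ.kerSubgroup) (conjH1 κ.kerSubgroup (charModule ∅ θquot) (τ i) u) = y i) ∧
        -- COT
        (∀ s : (datumStrictSelmer κ.kerSubgroup (charModule ∅ θsub) p (AcSelmer.bdpData (charModule ∅ θsub) p vbar) (↑Sf : Set (HeightOneSpectrum (𝓞 K)))), ∃ n : ℕ, p ^ n • s = 0) ∧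
        (∀ s : (datumStrictSelmer κ.kerSubgroup ↥((W.baseChange K).geomPrimaryTorsion p) p (AcSelmer.bdpData ↥((W.baseChange K).geomPrimaryTorsion p) p vbar) (↑Sf : Set (HeightOneSpectrum (𝓞 K)))), ∃ n : ℕ, p ^ n • s = 0) ∧
        (∀ s : (datumStrictSelmer κ.kerSubgroup (charModule ∅ θquot) p (AcSelmer.bdpData (charModule ∅ θquot) p vbar) (↑Sf : Set (HeightOneSpectrum (𝓞 K)))), ∃ n : ℕ, p ^ n • s = 0) ∧
        Finite (AddSubgroup.torsionBy (datumStrictSelmer κ.kerSubgroup (charModule ∅ θsub) p (AcSelmer.bdpData (charModule ∅ θsub) p vbar) (↑Sf : Set (HeightOneSpectrum (𝓞 K)))) (p : ℤ)) ∧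
        Finite (AddSubgroup.torsionBy (datumStrictSelmer κ.kerSubgroup ↥((W.baseChange K).geomPrimaryTorsion p) p (AcSelmer.bdpData ↥((W.baseChange K).geomPrimaryTorsion p) p vbar) (↑Sf : Set (HeightOneSpectrum (𝓞 K)))) (p : ℤ)) ∧
        Finite (AddSubgroup.torsionBy (datumStrictSelmer κ.kerSubgroup (charModule ∅ θquot) p (AcSelmer.bdpData (charModule ∅ θquot) p vbar) (↑Sf : Set (HeightOneSpectrum (𝓞 K)))) (p : ℤ)) ∧
        -- global H⁰
        (∀ x : (charModule ∅ θsub), (∀ g : ↥κ.kerSubgroup, g • x = x) → ∃ x' : (charModule ∅ θsub), (∀ g : ↥κ.kerSubgroup, g • x' = x') ∧ p • x' = x) ∧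
        (∀ x : ↥((W.baseChange K).geomPrimaryTorsion p), (∀ g : ↥κ.kerSubgroup, g • x = x) → ∃ x' : ↥((W.baseChange K).geomPrimaryTorsion p), (∀ g : ↥κ.kerSubgroup, g • x' = x') ∧ p • x' = x) ∧
        (∀ x : (charModule ∅ θquot), (∀ g : ↥κ.kerSubgroup, g • x = x) → ∃ x' : (charModule ∅ θquot), (∀ g : ↥κ.kerSubgroup, g • x' = x') ∧ p • x' = x) ∧
        (∀ n : ↥((W.baseChange K).geomTorsion (p : ℤ)), (∀ g : ↥κ.kerSubgroup, g • n = n) → n = 0) ∧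
        Finite {n : Φ.Quot // ∀ g : ↥κ.kerSubgroup, g • n = n} ∧
        Nat.card {n : Φ.Quot // ∀ g : ↥κ.kerSubgroup, g • n = n} = p ^ (if ∀ σ : absoluteGaloisGroup K, θquot σ = 1 then 1 else 0) ∧
        -- local H⁰ at `H ⊓ D_v̄`
        (∀ n : Φ.Sub, (∀ g : ↥(κ.kerSubgroup ⊓ decomp vbar), g • n = n) → n = 0) ∧
        (∀ (g : ↥(κ.kerSubgroup ⊓ decomp vbar)) (n : Φ.Quot), g • n = n) ∧
        Finite Φ.Quot ∧ Nat.card Φ.Quot = p ∧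
        (∀ x : (charModule ∅ θsub), (∀ g : ↥(κ.kerSubgroup ⊓ decomp vbar), g • x = x) → ∃ x' : (charModule ∅ θsub), (∀ g : ↥(κ.kerSubgroup ⊓ decomp vbar), g • x' = x') ∧ p • x' = x) ∧
        (∀ x : (charModule ∅ θquot), (∀ g : ↥(κ.kerSubgroup ⊓ decomp vbar), g • x = x) → ∃ x' : (charModule ∅ θquot), (∀ g : ↥(κ.kerSubgroup ⊓ decomp vbar), g • x' = x') ∧ p • x' = x) ∧
        -- H² bookkeeping
        Nat.card (↥(unramifiedOutside κ.kerSubgroup Φ.Quot p (↑Sf : Set (HeightOneSpectrum (𝓞 K)))) ⧸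
            ((unramifiedOutside κ.kerSubgroup ↥((W.baseChange K).geomTorsion (p : ℤ)) p (↑Sf : Set (HeightOneSpectrum (𝓞 K)))).map (resH1Hom (ContinuousMonoidHom.id ↥κ.kerSubgroup) Φ.proj
              (fun g b ↦ Φ.proj_smul (g : absoluteGaloisGroup K) b))).addSubgroupOf
                (unramifiedOutside κ.kerSubgroup Φ.Quot p (↑Sf : Set (HeightOneSpectrum (𝓞 K))))) *
            Nat.card (ModN (unramifiedOutside κ.kerSubgroup ↥((W.baseChange K).geomPrimaryTorsion p) p (↑Sf : Set (HeightOneSpectrum (𝓞 K)))) p) =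
          Nat.card (ModN (unramifiedOutside κ.kerSubgroup (charModule ∅ θsub) p (↑Sf : Set (HeightOneSpectrum (𝓞 K)))) p) * Nat.card (ModN (unramifiedOutside κ.kerSubgroup (charModule ∅ θquot) p (↑Sf : Set (HeightOneSpectrum (𝓞 K)))) p) := by
  intro h411 h422 h5A h41 h42 h32 h33 hT4 h263 hCD2 W _ _ p _ hp hgood hred hanom hlat K _ _ hK hH hHp htor ι v vbar hv hvbar hne
    κ hκ γ _ θsub θquot hpair Sf hSf hfgS htorS hμS hSsub hSquot
  exact IndexInputsShell.indexInputs_of_H2 h263 h41 h42 h5A h32 W p hp hanom hlat K hK hH htor ι v vbar hv hvbar hne κ hκ γ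
    θsub θquot hpair Sf hSf hfgS htorS hμS hSsub hSquot
    (fun Φ j₁ j₃ hj₁ hj₃ _ _ hj₁inj hj₃inj hr₁ hr₃ ↦ IndexInputsH2.natCard_H2_conjunct (hCD2 K) h41 h42 h5A h32 W hp hK hH hv
      hvbar hne κ hκ γ hpair Sf hSf hSsub hSquot Φ j₁ j₃ hj₁ hj₃ hj₁inj hj₃inj hr₁ hr₃)

end Summit.BirchSwinnertonDyer.BirchSwinnertonDyer.Theorems.GoodLatticeBDPValueIndexStubs

end
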